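import Summits.Ventures.PercRepro.PuncturedLYM

/-!
# PercRepro — (SP) FOR EVERY STEINER SYSTEM `S(j−1, j, n)`: THE TOUCHED SUPERSETS OF `X ∈ P` ARE ITS CODE NEIGHBOURS
(p10, gen 30; continues PuncturedLYM)

* `touchedCount_eq_card_codeNbrs` — for a code `D` and `X ∈ P`, the touched supersets `insert y X` of `X` are in bijection
  with the CODE NEIGHBOURS of `X` (the code words meeting `X` in exactly `j − 1` elements): `t(X) = #codeNbrs(X)` — proved by
  two double counts (`[touched] = Σ_B [B ⊆ insert y X]`, and a code word `B` is completed by exactly one point `y ∉ X`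
  iff it is a code neighbour);
* `card_codeNbrs_of_steiner` — in a Steiner system `S(j−1, j, n)` (every `(j−1)`-set in a block — exactly one, by the
  code property) every `X ∈ P` has exactly `j` code neighbours, one through each `(j−1)`-subset;
* `puncturedNMP_of_steiner` — hence **(SP) holds for every Steiner system**: the code is regular with `t₀ = j`
  (`puncturedNMP_of_regular`).  Examples: the Fano plane `S(2,3,7)`, `AG(3,2) = S(3,4,8)`, the Witt designs `S(4,5,11)`,
  `S(5,6,12)`, every projective and affine plane.  For `S(j−1, j, n)` every `X ∈ P` has exactly `j` touched and `n − 2j`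
  untouched supersets, and the regular weights are the exact (proportional) coupling of gen 29 §8.
Nothing here asserts (SP).
-/

namespace PercRepro.PuncturedLYM

open Finset

variable {α : Type} [Fintype α] [DecidableEq α]

/-! ### Code neighbours and Steiner systems -/

/-- The code neighbours of `X`: the code words meeting `X` in exactly `j − 1` elements. -/
def codeNbrs (j : ℕ) (D : Finset (Finset α)) (X : Finset α) : Finset (Finset α) :=
  D.filter (fun B => (B ∩ X).card + 1 = j)

omit [Fintype α] in
/-- `B ⊆ insert y X ↔ B \ X ⊆ {y}`. -/
theorem subset_insert_iff_sdiff_subset {B X : Finset α} {y : α} : B ⊆ insert y X ↔ B \ X ⊆ {y} := by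
  constructor
  · intro h z hz
    rw [mem_sdiff] at hz
    have := h hz.1
    rw [mem_insert] at this
    rw [mem_singleton]
    exact this.resolve_right hz.2
  · intro h z hz
    by_cases hzX : z ∈ X
    · exact mem_insert_of_mem hzX
    · have := h (mem_sdiff.2 ⟨hz, hzX⟩)
      rw [mem_singleton] at this
      rw [this]
      exact mem_insert_self y X

/-- For a code word `B` and `X ∈ P`, the points `y ∉ X` with `B ⊆ insert y X` number `1` when `B` is a code neighbour
of `X` and `0` otherwise. -/
theorem card_filter_subset_insert {j : ℕ} {D : Finset (Finset α)} (hD : IsCode j D) {X : Finset α}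
    (hX : X ∈ punctured j D) {B : Finset α} (hB : B ∈ D) :
    ((univ \ X).filter (fun y => B ⊆ insert y X)).card = if (B ∩ X).card + 1 = j then 1 else 0 := by
  have hBc : B.card = j := hD.1 B hB
  obtain ⟨hXc, hXD⟩ := mem_punctured.1 hX
  have hne : B ≠ X := fun h => hXD (h ▸ hB)
  have hsd : (B \ X).card = j - (B ∩ X).card := by
    rw [card_sdiff, inter_comm, hBc]
  split_ifs with ht
  · -- `B \ X` is a singleton `{y₀}` and the filter is `{y₀}`
    have h1 : (B \ X).card = 1 := by omega
    obtain ⟨y₀, hy₀⟩ := card_eq_one.1 h1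
    have hy₀X : y₀ ∉ X := by
      have : y₀ ∈ B \ X := hy₀ ▸ mem_singleton_self y₀
      exact (mem_sdiff.1 this).2
    rw [card_eq_one]
    refine ⟨y₀, ?_⟩
    ext y
    simp only [mem_filter, mem_sdiff, mem_univ, true_and, subset_insert_iff_sdiff_subset, hy₀, singleton_subset_iff,
      mem_singleton]
    constructor
    · rintro ⟨-, h⟩
      exact h.symm
    · rintro rfl
      exact ⟨hy₀X, rfl⟩
  · -- `B \ X` has at least two elements: no single point completes `B`
    have hnot : ¬ B ⊆ X := fun h => hne (eq_of_subset_of_card_le h (by omega))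
    have h1 : 1 ≤ (B \ X).card := by
      rw [Nat.one_le_iff_ne_zero, Ne, card_eq_zero, sdiff_eq_empty_iff_subset]
      exact hnot
    have h2 : 2 ≤ (B \ X).card := by
      rcases Nat.lt_or_ge 1 (B \ X).card with h | h
      · exact h
      · exfalso
        have : (B \ X).card = 1 := by omega
        exact ht (by omega)
    rw [card_eq_zero, filter_eq_empty_iff]
    intro y _ hy
    rw [subset_insert_iff_sdiff_subset] at hy
    have := card_le_card hy
    rw [card_singleton] at this
    omega

omit [Fintype α] in
/-- `#(D ∩ 2^Y) = #{B ∈ D : B ⊆ Y}`. -/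
theorem card_filter_subset_eq_card_filter_mem {j : ℕ} {D : Finset (Finset α)} (hD : IsCode j D) (Y : Finset α) :
    (D.filter (fun B => B ⊆ Y)).card = ((Y.powersetCard j).filter (fun X => X ∈ D)).card := by
  congr 1
  ext B
  simp only [mem_filter, mem_powersetCard]
  constructor
  · rintro ⟨hB, hBY⟩
    exact ⟨⟨hBY, hD.1 B hB⟩, hB⟩
  · rintro ⟨⟨hBY, -⟩, hB⟩
    exact ⟨hB, hBY⟩

/-- **The touched supersets of `X ∈ P` are counted by its code neighbours**: `t(X) = #codeNbrs(X)`. -/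
theorem touchedCount_eq_card_codeNbrs {j : ℕ} {D : Finset (Finset α)} (hD : IsCode j D) {X : Finset α}
    (hX : X ∈ punctured j D) : touchedCount D X = (codeNbrs j D X).card := by
  obtain ⟨hXc, -⟩ := mem_punctured.1 hX
  unfold touchedCount codeNbrs
  rw [card_filter, card_filter]
  -- `[Touched (insert y X)] = Σ_{B ∈ D} [B ⊆ insert y X]`, then swap
  have hpt : ∀ y ∈ univ \ X, (if Touched D (insert y X) then 1 else 0) = ∑ B ∈ D, if B ⊆ insert y X then 1 else 0 := by
    intro y hy
    have hy' : y ∉ X := (mem_sdiff.1 hy).2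
    rw [← card_filter, card_filter_subset_eq_card_filter_mem hD, card_filter_mem_code hD
      (by rw [card_insert_of_notMem hy', hXc])]
  rw [sum_congr rfl hpt, sum_comm]
  apply sum_congr rfl
  intro B hB
  rw [← card_filter, card_filter_subset_insert hD hX hB]

/-- A Steiner system `S(j−1, j, n)`: a code in which every `(j−1)`-set lies in a block (necessarily exactly one). -/
def IsSteiner (j : ℕ) (D : Finset (Finset α)) : Prop :=
  IsCode j D ∧ ∀ S : Finset α, S.card + 1 = j → ∃ B ∈ D, S ⊆ B

/-- In a Steiner system every `X ∈ P` has exactly `j` code neighbours (one through each `(j−1)`-subset). -/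
theorem card_codeNbrs_of_steiner {j : ℕ} {D : Finset (Finset α)} (hS : IsSteiner j D) {X : Finset α}
    (hX : X ∈ punctured j D) : (codeNbrs j D X).card = j := by
  obtain ⟨hD, hcov⟩ := hS
  obtain ⟨hXc, hXD⟩ := mem_punctured.1 hX
  rcases Nat.eq_zero_or_pos j with hj0 | hj
  · -- `j = 0`: no code word meets `X` in `−1` elements
    subst hj0
    unfold codeNbrs
    rw [card_eq_zero, filter_eq_empty_iff]
    intro B _ h
    omega
  -- `#codeNbrs = Σ_{B ∈ D} [#(B ∩ X) + 1 = j] = Σ_{B ∈ D} Σ_{S ∈ C(X, j−1)} [S ⊆ B] = Σ_S Σ_B [S ⊆ B] = Σ_S 1 = j`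
  have hBX : ∀ B ∈ D, (if (B ∩ X).card + 1 = j then 1 else 0) =
      ∑ S ∈ X.powersetCard (j - 1), if S ⊆ B then 1 else 0 := by
    intro B hB
    have hBc : B.card = j := hD.1 B hB
    have hne : B ≠ X := fun h => hXD (h ▸ hB)
    have hlt : (B ∩ X).card < j := by
      rcases Nat.lt_or_ge (B ∩ X).card j with h | h
      · exact h
      · exfalso
        have h1 : B ∩ X = B := eq_of_subset_of_card_le inter_subset_left (by omega)
        have h2 : B ⊆ X := h1 ▸ inter_subset_right
        exact hne (eq_of_subset_of_card_le h2 (by omega))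
    rw [← card_filter]
    split_ifs with ht
    · -- exactly one `S`: `S = B ∩ X`
      symm
      rw [card_eq_one]
      refine ⟨B ∩ X, ?_⟩
      ext S
      simp only [mem_filter, mem_powersetCard, mem_singleton]
      constructor
      · rintro ⟨⟨hSX, hSc⟩, hSB⟩
        exact eq_of_subset_of_card_le (subset_inter hSB hSX) (by omega)
      · rintro rfl
        exact ⟨⟨inter_subset_right, by omega⟩, inter_subset_left⟩
    · symm
      rw [card_eq_zero, filter_eq_empty_iff]
      intro S hS hSB
      rw [mem_powersetCard] at hS
      have := card_le_card (subset_inter hSB hS.1)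
      omega
  have hS1 : ∀ S ∈ X.powersetCard (j - 1), ∑ B ∈ D, (if S ⊆ B then 1 else 0) = 1 := by
    intro S hS
    rw [mem_powersetCard] at hS
    have hSc : S.card + 1 = j := by omega
    rw [← card_filter, card_eq_one]
    obtain ⟨B, hB, hSB⟩ := hcov S hSc
    refine ⟨B, ?_⟩
    ext B'
    simp only [mem_filter, mem_singleton]
    constructor
    · rintro ⟨hB', hSB'⟩
      -- two blocks through `S` meet in `≥ j − 1` elements: equal
      by_contra hne
      have h1 := hD.2 B' hB' B hB hne
      have h2 : S ⊆ B' ∩ B := subset_inter hSB' hSB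
      have h3 := card_le_card h2
      omega
    · rintro rfl
      exact ⟨hB, hSB⟩
  unfold codeNbrs
  rw [card_filter, sum_congr rfl hBX, sum_comm, sum_congr rfl hS1, sum_const, smul_eq_mul, mul_one,
    card_powersetCard, hXc, Nat.choose_symm (by omega : 1 ≤ j), Nat.choose_one_right]

/-- **(SP) holds for every Steiner system `S(j−1, j, n)`**: every `X ∈ P` has exactly `j` touched supersets, so the
code is regular with `t₀ = j`. -/
theorem puncturedNMP_of_steiner {j : ℕ} {D : Finset (Finset α)} (hS : IsSteiner j D) (hj : 0 < j) :
    PuncturedNMP j D :=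
  puncturedNMP_of_regular hS.1 hj j (fun X hX => by
    rw [touchedCount_eq_card_codeNbrs hS.1 hX, card_codeNbrs_of_steiner hS hX])

end PercRepro.PuncturedLYM
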